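import Summits.HubbardSuperconductivity.HubbardSuperconductivity.Theorems.KLProgrammeKLRegimeFlowReadScaleZeroSunsetCertRowsTwoShells

/-!
# Route `KLProgramme`, crux K3 — engine-flow child (stmt-HubbardSuperconductivity-20437), stub (C) at `n = 0`, located item #22a «(C)-SCALE0-PT2»:
# the strip door's volume side condition, discharged at the engine's volume threshold

Seat hubbard-kl-k3c5-p1 (g14; owner of #22a).  `sunsetRows_of_certV3_twoShells` (`…SunsetCertRowsTwoShells`) carries the hypothesis
`e^{−arsinh(ω₁/4)·L/2} ≤ 1/2` of p1 g21's finite-volume strip door.  For the crossover `ω₁ ≥ klE0 = 1/32` one has `arsinh(ω₁/4) ≥ 1/256`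
(`sinh(1/256) ≤ 1/128`), so `L ≥ 1024` suffices (`e^{−2} ≤ 1/3 ≤ 1/2`); and `klEngL₃ β U = 2¹⁰(⌈|β|⌉+1)²(⌈|U|⁻¹⌉+1)² ≥ 1024`:
* `sinh_le_two_mul` (`0 ≤ y ≤ 1 ⇒ sinh y ≤ 2y`), `arsinh_klE0_div_four_ge` (`klE0 ≤ ω₁ ⇒ 1/256 ≤ arsinh(ω₁/4)`),
* **`exp_strip_le_half_of_le`** (`klE0 ≤ ω₁`, `1024 ≤ L`), **`exp_strip_le_half_of_klEngL₃`** (`klE0 ≤ ω₁`, `klEngL₃ β U ≤ L`).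

No definitions; nothing here asserts (C), any stub of 20437, K3 or superconductivity.
References: BGM 2006 §2.2 footnote 1 [cite: BenfattoGiulianiMastropietro2006].
-/

noncomputable section

namespace Summit.HubbardSuperconductivity.HubbardSuperconductivity.Theorems.KLRegimeSplit

set_option linter.dupNamespace false -- summit = problem name (single-conjunct summit), D-0017

open Summit.HubbardSuperconductivity.HubbardSuperconductivity.Theorems.EngineV8 Real

/-- `sinh y ≤ 2y` for `0 ≤ y ≤ 1` (from `|e^{±y} − 1 ∓ y| ≤ y²`). -/
theorem sinh_le_two_mul {y : ℝ} (h0 : 0 ≤ y) (h1 : y ≤ 1) : Real.sinh y ≤ 2 * y := by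
  rw [Real.sinh_eq]
  have hy : |y| ≤ 1 := by rw [abs_of_nonneg h0]; exact h1
  have hy' : |(-y)| ≤ 1 := by rw [abs_neg]; exact hy
  have h1' := (abs_le.1 (Real.abs_exp_sub_one_sub_id_le hy)).2
  have h2' := (abs_le.1 (Real.abs_exp_sub_one_sub_id_le hy')).1
  nlinarith

/-- For `klE0 ≤ ω₁`: `1/256 ≤ arsinh(ω₁/4)` (`sinh(1/256) ≤ 1/128 = klE0/4`). -/
theorem arsinh_klE0_div_four_ge {ω₁ : ℝ} (hω₁ : klE0 ≤ ω₁) : (1 / 256 : ℝ) ≤ Real.arsinh (ω₁ / 4) := by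
  have hs : Real.sinh (1 / 256 : ℝ) ≤ ω₁ / 4 := by
    have h := sinh_le_two_mul (y := 1 / 256) (by norm_num) (by norm_num)
    have hE : klE0 = 1 / 32 := by norm_num [klE0]
    linarith
  have := Real.sinh_le_sinh.1 (hs.trans_eq (Real.sinh_arsinh _).symm)
  exact this

/-- **The strip door's volume condition at the crossover**: `klE0 ≤ ω₁` and `1024 ≤ L` give `e^{−arsinh(ω₁/4)·L/2} ≤ 1/2`. -/
theorem exp_strip_le_half_of_le {ω₁ : ℝ} (hω₁ : klE0 ≤ ω₁) {L : ℕ} (hL : (1024 : ℝ) ≤ L) :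
    Real.exp (-(Real.arsinh (ω₁ / 4) * L / 2)) ≤ 1 / 2 := by
  have hκ := arsinh_klE0_div_four_ge hω₁
  have hprod : (2 : ℝ) ≤ Real.arsinh (ω₁ / 4) * L / 2 := by
    have : (1 / 256 : ℝ) * 1024 ≤ Real.arsinh (ω₁ / 4) * L := mul_le_mul hκ hL (by norm_num) (le_trans (by norm_num) hκ)
    linarith
  calc Real.exp (-(Real.arsinh (ω₁ / 4) * L / 2)) ≤ Real.exp (-2) := Real.exp_le_exp.2 (by linarith)
    _ ≤ 1 / 2 := by
        rw [Real.exp_neg, inv_le_comm₀ (Real.exp_pos _) (by norm_num)]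
        have := Real.add_one_le_exp (2 : ℝ)
        norm_num at this ⊢
        linarith

/-- The engine's volume threshold is at least `1024`. -/
theorem klEngL₃_ge_1024 (β U : ℝ) : 1024 ≤ klEngL₃ β U := by
  unfold klEngL₃
  have h1 : 1 ≤ (⌈|β|⌉₊ + 1) ^ 2 := Nat.one_le_pow _ _ (Nat.succ_pos _)
  have h2 : 1 ≤ (⌈|U|⁻¹⌉₊ + 1) ^ 2 := Nat.one_le_pow _ _ (Nat.succ_pos _)
  calc 1024 = 2 ^ 10 * 1 * 1 := by norm_num
    _ ≤ 2 ^ 10 * (⌈|β|⌉₊ + 1) ^ 2 * (⌈|U|⁻¹⌉₊ + 1) ^ 2 := by gcongr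

/-- **The strip door's volume condition in the engine regime**: `klE0 ≤ ω₁` and `klEngL₃ β U ≤ L` give `e^{−arsinh(ω₁/4)·L/2} ≤ 1/2`. -/
theorem exp_strip_le_half_of_klEngL₃ {ω₁ β U : ℝ} (hω₁ : klE0 ≤ ω₁) {L : ℕ} (hL : klEngL₃ β U ≤ L) :
    Real.exp (-(Real.arsinh (ω₁ / 4) * L / 2)) ≤ 1 / 2 := by
  refine exp_strip_le_half_of_le hω₁ ?_
  have h := (klEngL₃_ge_1024 β U).trans hL
  exact_mod_cast h

end Summit.HubbardSuperconductivity.HubbardSuperconductivity.Theorems.KLRegimeSplit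

end
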